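import Literature.Computability.AlgebraicComplexity.Hyperdeterminant
import Literature.Computability.AlgebraicComplexity.HessianAtOrigin
import Literature.Computability.AlgebraicComplexity.MignonRessayreBound
import Mathlib.Analysis.Complex.Basic

/-!
# `DetqpThesis` (stmt-ValiantsHypothesis-0315), line `Sketch` (idea four-dimensional-determinant) —
# stub T1a: the Hessian of the generic four-dimensional hyperdeterminant at a point

Write `HD_n := hyperdet (fun I : Fin 4 → Fin n => X I)` for the generic four-dimensional Cayley
hyperdeterminant over `ℂ` (tree `Literature.Computability.AlgebraicComplexity.hyperdet`,
`HD_n = ∑_{σ₀,σ₁,σ₂,σ₃ ∈ 𝔖_n} (∏_j sgn σ_j) ∏_i x_{σ₀ i, σ₁ i, σ₂ i, σ₃ i}`).  This file computes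
the entries of the Hessian of `HD_n` at an arbitrary point `x` (`hess0 (transl x HD_n)`, the
tree's analysis-free Hessian at a point, `hess0_transl`) as an explicit finite sum: plain formal
calculus.

* §1 Leibniz for a monomial in arbitrary (possibly repeated) variables `∏_{i ∈ S} X_{v i}`:
  `∂_t ∏_{i ∈ S} X_{v i} = ∑_{q ∈ S, v q = t} ∏_{i ∈ S ∖ q} X_{v i}` (`hdHess_pderiv_prod_X`), hence
  `∂_s ∂_t ∏_{i ∈ S} X_{v i} = ∑_{p ≠ q ∈ S, v p = s, v q = t} ∏_{i ∈ S ∖ {p, q}} X_{v i}`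
  (`hdHess_pderiv_pderiv_prod_X`) and its value at a point (`hdHess_eval_pderiv_pderiv_prod_X`).
  No injectivity of `v` is needed.
* §2 Summing over `σ` with the constant signs (`pderiv_C_mul`) gives the entry `(I, J)` of the
  Hessian of `HD_n` at `x` (`stub_hess0_hyperdet_eq_sum`): the sum over `σ` and over ordered pairs
  of positions `p ≠ q` carrying the variables `x_I` and `x_J` of the signed product of the remaining
  `n - 2` entries of `x` along `σ`.

Sources: folklore (Leibniz rule); the permanent analogue is `hess0_transl_perPoly` of
`MignonRessayreBound.lean` (T. Mignon, N. Ressayre (2004), §3).  Not here: the other stubs of the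
line (the block-point specialisation T1b, the pattern-matrix injectivity T2, `¬ qp dc(HD)`).
-/

noncomputable section

-- single-conjunct layout: Sub = Summit, duplicated namespace component intended
set_option linter.dupNamespace false

namespace Summit.ValiantsHypothesis.ValiantsHypothesis.Theorems.DetQPDetqpThesis

open Literature.Computability.AlgebraicComplexity MvPolynomial

section Leibniz

variable {k : Type*} [CommRing k] {τ ι : Type*} [DecidableEq ι]

/-- First partial derivative of a monomial in arbitrary variables:
`∂_t ∏_{i ∈ S} X_{v i} = ∑_{q ∈ S} [v q = t] ∏_{i ∈ S ∖ q} X_{v i}`. [folklore] -/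
theorem hdHess_pderiv_prod_X [DecidableEq τ] (t : τ) (S : Finset ι) (v : ι → τ) :
    pderiv t (∏ i ∈ S, (X (v i) : MvPolynomial τ k)) =
      ∑ q ∈ S, if v q = t then ∏ i ∈ S.erase q, (X (v i) : MvPolynomial τ k) else 0 := by
  rw [pderiv_finset_prod]
  refine Finset.sum_congr rfl fun q _ => ?_
  by_cases h : v q = t
  · rw [if_pos h, h, pderiv_X_self, mul_one]
  · rw [if_neg h, pderiv_X_of_ne h, mul_zero]

/-- Second partial derivatives of a monomial in arbitrary variables:
`∂_s ∂_t ∏_{i ∈ S} X_{v i} = ∑_{p, q ∈ S} [p ≠ q, v p = s, v q = t] ∏_{i ∈ S ∖ {p, q}} X_{v i}`.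
[folklore] -/
theorem hdHess_pderiv_pderiv_prod_X [DecidableEq τ] (s t : τ) (S : Finset ι) (v : ι → τ) :
    pderiv s (pderiv t (∏ i ∈ S, (X (v i) : MvPolynomial τ k))) =
      ∑ p ∈ S, ∑ q ∈ S, if p ≠ q ∧ v p = s ∧ v q = t
        then ∏ i ∈ (S.erase p).erase q, (X (v i) : MvPolynomial τ k) else 0 := by
  rw [hdHess_pderiv_prod_X, map_sum]
  conv_rhs => rw [Finset.sum_comm]
  refine Finset.sum_congr rfl fun q hq => ?_
  by_cases ht : v q = t
  · rw [if_pos ht, hdHess_pderiv_prod_X, ← Finset.sum_erase S (a := q)]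
    · refine Finset.sum_congr rfl fun p hp => ?_
      have hpq : p ≠ q := (Finset.mem_erase.mp hp).1
      by_cases hs : v p = s
      · rw [if_pos hs, if_pos ⟨hpq, hs, ht⟩, Finset.erase_right_comm]
      · rw [if_neg hs, if_neg fun h => hs h.2.1]
    · exact if_neg fun h => h.1 rfl
  · rw [if_neg ht, map_zero]
    refine (Finset.sum_eq_zero fun p _ => ?_).symm
    exact if_neg fun h => ht h.2.2

/-- The value at a point `x` of the second partial derivatives of a monomial in arbitrary
variables:
`(∂_s ∂_t ∏_{i ∈ S} X_{v i})(x) = ∑_{p ≠ q ∈ S, v p = s, v q = t} ∏_{i ∈ S ∖ {p, q}} x_{v i}`.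
[folklore] -/
theorem hdHess_eval_pderiv_pderiv_prod_X [DecidableEq τ] (x : τ → k) (s t : τ) (S : Finset ι)
    (v : ι → τ) :
    eval x (pderiv s (pderiv t (∏ i ∈ S, (X (v i) : MvPolynomial τ k)))) =
      ∑ p ∈ S, ∑ q ∈ S, if p ≠ q ∧ v p = s ∧ v q = t
        then ∏ i ∈ (S.erase p).erase q, x (v i) else 0 := by
  rw [hdHess_pderiv_pderiv_prod_X, map_sum]
  refine Finset.sum_congr rfl fun p _ => ?_
  rw [map_sum]
  refine Finset.sum_congr rfl fun q _ => ?_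
  split_ifs
  · rw [map_prod]
    exact Finset.prod_congr rfl fun i _ => eval_X _
  · exact map_zero _

end Leibniz

section Hyperdet

variable {n : ℕ}

/-- The sign of a term of the generic hyperdeterminant is a constant polynomial:
`∏_j sgn σ_j = C (∏_j sgn σ_j)`. [folklore] -/
theorem hdHess_prod_sign_eq_C (σ : Fin 4 → Equiv.Perm (Fin n)) :
    (∏ j, (Equiv.Perm.sign (σ j) : MvPolynomial (Fin 4 → Fin n) ℂ)) =
      C (∏ j, (Equiv.Perm.sign (σ j) : ℂ)) := by
  rw [map_prod]
  exact Finset.prod_congr rfl fun j _ =>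
    (map_intCast (C : ℂ →+* MvPolynomial (Fin 4 → Fin n) ℂ) _).symm

/-- T1a — **the Hessian of `HD_n` at an arbitrary point**, as an explicit finite sum: the second
partial `∂_I ∂_J` of the monomial `∏_i x_{σ₀ i, σ₁ i, σ₂ i, σ₃ i}` is the sum over ordered pairs of
positions `p ≠ q` carrying `x_I` and `x_J` of the product of the remaining `n - 2` variables
(Leibniz; cf. `pderiv_pderiv_prod_X_perm` for the permanent), evaluated at `x` (`hess0_transl`).
[folklore] -/
theorem stub_hess0_hyperdet_eq_sum (n : ℕ) (x : (Fin 4 → Fin n) → ℂ) (I J : Fin 4 → Fin n) :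
    hess0 (transl x (hyperdet (fun I : Fin 4 → Fin n => (X I : MvPolynomial (Fin 4 → Fin n) ℂ)))) I J =
    ∑ σ : Fin 4 → Equiv.Perm (Fin n), (∏ j, (Equiv.Perm.sign (σ j) : ℂ)) *
      ∑ p : Fin n, ∑ q : Fin n,
        if p ≠ q ∧ (fun j => σ j p) = I ∧ (fun j => σ j q) = J
        then ∏ i ∈ (Finset.univ.erase p).erase q, x (fun j => σ j i) else 0 := by
  rw [hess0_transl]
  unfold hyperdet
  simp only [map_sum]
  refine Finset.sum_congr rfl fun σ _ => ?_
  rw [hdHess_prod_sign_eq_C, pderiv_C_mul, pderiv_C_mul, map_mul, eval_C]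
  congr 1
  exact hdHess_eval_pderiv_pderiv_prod_X x I J Finset.univ fun i j => σ j i

end Hyperdet

end Summit.ValiantsHypothesis.ValiantsHypothesis.Theorems.DetQPDetqpThesis

end
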